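import Literature.RepresentationTheory.TwistedCoinvariantsCompactIsotypic   -- ★ `TwistedCoinv.exists_linearEquiv_weightSpace_coinv`, `map_weightSpace_le` (+ ★ `TwistedCoinv.rep`, `mk_ρW`, `weightSpace`, `Representation.IsSmooth`)
import Literature.NumberTheory.Automorphic.MatrixCoefficients                -- ★ `Representation.IsUnitarizable` (invariant positive-definite Hermitian form)
import HarnessLib

/-!
# Twisted coinvariants by a compact group acting smoothly inherit unitarizability
# ([BernsteinZelevinsky1976, §2.3]; [MoeglinVignerasWaldspurger1987, Chap. 2 II.2]; [BushnellHenniart2006, §2.6])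

Topic `RepresentationTheory`; namespace `Literature.RepresentationTheory.TwistedCoinv` (continuing ★ `TwistedCoinvariants`,
★ `TwistedCoinvariantsCompactEigenvector`, ★ `TwistedCoinvariantsCompactIsotypic`).  KERNEL ONLY: theorems, 0 definitions, 0 named facts, 0 sorry.
Cell `hodgecm-mathlib`, crux H413, programme P3b line L1′ «KeysPnUnitary» (`Cruxes/H413/Lines/F0_P3b_KeysPnUnitaryPaydown.lean`, commit 7587733413f3):
this file CLOSES its generic stub U1b `stub_isUnitarizable_twistedCoinv` BY NAME-FREE CONTENT (`isUnitarizable_rep`, same binders, same conclusion).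

THE MATHEMATICS.  Let `ρW : H → GL(S)` be a SMOOTH representation of a COMPACT topological group `H` (every vector has an open stabiliser), `χ : H →* ℂˣ`
ANY character (no continuity assumed), and `ρV : G → GL(S)` a representation of a group `G` commuting with `ρW(H)`.  The `χ`-coinvariants
`S_{H,χ} = S ⧸ ⟨ρW(h) w − χ(h) w⟩` carry the representation `TwistedCoinv.rep χ ρV hc` of `G` (★ `TwistedCoinvariants`).  CLAIM: if `ρV` is unitarizable
(★ `Representation.IsUnitarizable`: an invariant positive-definite Hermitian form, no completion), so is `rep χ ρV hc`.  PROOF — a dichotomy on `χ`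
(`isOpen_ker_or_subsingleton_coinv`, valid over any field and WITHOUT compactness):
* either SOME vector `w` has `χ` trivial on its (open) stabiliser — then `ker χ` contains an open subgroup, hence is OPEN; for `H` compact ★
  `exists_linearEquiv_weightSpace_coinv` identifies `S_{H,χ}` with the `χ`-ISOTYPIC SUBSPACE `{v | ρW(h) v = χ(h) v}` (a `ρV`-stable subspace, ★ `map_weightSpace_le`),
  the identification intertwining `rep χ ρV hc` with `ρV` (★ `rep_mk`), and the invariant form of `ρV` RESTRICTS along this injective intertwiner
  (`Representation.IsUnitarizable.of_injective_intertwiner`);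
* or EVERY vector `w` has some `k` in its stabiliser with `χ(k) ≠ 1` — then `mk w = mk (ρW(k) w) = χ(k) • mk w` (★ `mk_ρW`) forces `mk w = 0`: the coinvariants
  VANISH (`Subsingleton`), and the zero space is unitarizable (the zero form).

* `Representation.IsUnitarizable.of_injective_intertwiner` — unitarizability pulls back along an injective intertwiner (Literature-side twin of the cell's
  Theorems-side ★ `F0P3LocalConstituentsUnitary.isUnitarizable_of_injective`, which a Literature module may not import).
* `Representation.IsUnitarizable.of_subsingleton` — a representation on a trivial module is unitarizable.
* `TwistedCoinv.isOpen_ker_or_subsingleton_coinv (hρ : ρ.IsSmooth) : IsOpen (χ.ker : Set H) ∨ Subsingleton (Coinv ρ χ)` (any field, any topological group).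
* `TwistedCoinv.exists_injective_intertwiner_weightSpace` — `H` compact, `ρW` smooth, `ker χ` open: an injective `ℂ`-linear `f : Coinv ρW χ → S` with
  `f ∘ rep χ ρV hc g = ρV g ∘ f` and image the `χ`-isotypic subspace.
* **`TwistedCoinv.isUnitarizable_rep (χ) (ρV) (hc) (hsm : ρW.IsSmooth) (hρV : ρV.IsUnitarizable) : (rep χ ρV hc).IsUnitarizable`** (`H` compact) — THE STUB U1b.

References: [BernsteinZelevinsky1976] I. N. Bernstein, A. V. Zelevinsky, Russian Math. Surveys 31 (1976) §2.1–2.3 (coinvariants of compact totally disconnected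
groups); [MoeglinVignerasWaldspurger1987] LNM 1291, Chap. 2 II.2; [BushnellHenniart2006] C. Bushnell, G. Henniart, Grundlehren 335, §2.6 (unitarizability
is inherited by subrepresentations), §1.1.
HONEST LABEL (cell): HC_CM is proved only modulo the printed citations until rung 0 closes.
-/

set_option autoImplicit false

noncomputable section

/-! ## §1 Unitarizability: pullback along injective intertwiners; the zero representation -/

namespace Representation

variable {G V W : Type*} [Group G] [AddCommGroup V] [Module ℂ V] [AddCommGroup W] [Module ℂ W]

/-- **Unitarizability pulls back along an injective intertwiner** [BushnellHenniart2006 §2.6: a subrepresentation of a unitarizable representation is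
unitarizable]: if `f : V → W` is `ℂ`-linear, injective, and intertwines `ρ` with a unitarizable `σ`, then `B_ρ(x, y) := B_σ(f x, f y)` is an invariant
positive-definite Hermitian form for `ρ`. [cite: BushnellHenniart2006, §2.6] -/
theorem IsUnitarizable.of_injective_intertwiner {ρ : Representation ℂ G V} {σ : Representation ℂ G W} (hσ : σ.IsUnitarizable)
    (f : V →ₗ[ℂ] W) (hf : ∀ (g : G) (v : V), f (ρ g v) = σ g (f v)) (hinj : Function.Injective f) : ρ.IsUnitarizable := by
  obtain ⟨B, hBsymm, hBpos, hBinv⟩ := hσ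
  refine ⟨LinearMap.mk₂'ₛₗ (starRingEnd ℂ) (RingHom.id ℂ) (fun x y : V => B (f x) (f y))
      (fun x x' y => by simp only [map_add, LinearMap.add_apply])
      (fun a x y => by simp only [map_smulₛₗ, LinearMap.smul_apply, smul_eq_mul, RingHom.id_apply])
      (fun x y y' => by simp only [map_add]) (fun a x y => by simp only [map_smul, RingHom.id_apply, smul_eq_mul]), ?_, ?_, ?_⟩
  · exact ⟨fun x y => hBsymm.eq (f x) (f y)⟩
  · intro v hv
    exact hBpos (f v) fun h0 => hv (hinj (by rw [h0, map_zero]))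
  · intro g v w
    change B (f (ρ g v)) (f (ρ g w)) = B (f v) (f w)
    rw [hf, hf, hBinv]

/-- **A representation on a trivial module is unitarizable** (the zero form is invariant, and positive-definiteness is vacuous). [cite: BushnellHenniart2006, §1.1] -/
theorem IsUnitarizable.of_subsingleton [Subsingleton V] (ρ : Representation ℂ G V) : ρ.IsUnitarizable :=
  ⟨0, LinearMap.isSymm_zero, fun v hv => absurd (Subsingleton.elim v 0) hv, fun _ _ _ => by simp only [LinearMap.zero_apply]⟩

end Representation

/-! ## §2 The dichotomy on the character; the isotypic model of the coinvariants; the stub U1b -/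

namespace Literature.RepresentationTheory.TwistedCoinv

open Literature.RepresentationTheory

section Dichotomy

variable {k : Type*} [Field k] {H : Type*} [Group H] [TopologicalSpace H] [IsTopologicalGroup H]
  {S : Type*} [AddCommGroup S] [Module k S] (ρ : Representation k H S) (χ : H →* kˣ)

/-- **DICHOTOMY for the `χ`-coinvariants of a smooth representation** (any topological group `H`, any field, `χ` any character — no continuity):
either `ker χ` is OPEN (some vector has `χ` trivial on its open stabiliser, and a subgroup containing an open subgroup is open), or the coinvariants
VANISH (every vector `w` has `k ∈ Stab(w)` with `χ(k) ≠ 1`, and `mk w = mk (ρ k w) = χ(k) • mk w` forces `mk w = 0`).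
[cite: BernsteinZelevinsky1976, §2.3] [cite: MoeglinVignerasWaldspurger1987, Chap. 2 II.2] -/
theorem isOpen_ker_or_subsingleton_coinv (hρ : ρ.IsSmooth) : IsOpen (χ.ker : Set H) ∨ Subsingleton (Coinv ρ χ) := by
  by_cases h : ∃ w : S, ∀ x ∈ ρ.stabilizerSubgroup w, χ x = 1
  · obtain ⟨w, hw⟩ := h
    exact Or.inl (Subgroup.isOpen_mono (H₁ := ρ.stabilizerSubgroup w) (fun x hx => (MonoidHom.mem_ker).2 (hw x hx)) (hρ w))
  · push Not at h
    refine Or.inr ⟨fun x y => ?_⟩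
    -- every class vanishes
    have hzero : ∀ w : S, mk ρ χ w = 0 := fun w => by
      obtain ⟨x, hx, hχx⟩ := h w
      have e : mk ρ χ w = ((χ x : kˣ) : k) • mk ρ χ w := by
        conv_lhs => rw [← (ρ.mem_stabilizerSubgroup w x).1 hx]
        exact mk_ρW ρ χ x w
      have hne : (1 : k) - ((χ x : kˣ) : k) ≠ 0 := fun h0 => hχx (Units.ext (by rw [Units.val_one]; exact (sub_eq_zero.1 h0).symm))
      have e' : ((1 : k) - ((χ x : kˣ) : k)) • mk ρ χ w = 0 := by rw [sub_smul, one_smul, ← e, sub_self]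
      exact (smul_eq_zero.1 e').resolve_left hne
    obtain ⟨v, rfl⟩ := mk_surjective ρ χ x
    obtain ⟨v', rfl⟩ := mk_surjective ρ χ y
    rw [hzero v, hzero v']

end Dichotomy

section Compact

variable {G H S : Type*} [Group G] [Group H] [TopologicalSpace H] [IsTopologicalGroup H] [CompactSpace H]
  [AddCommGroup S] [Module ℂ S] {ρW : Representation ℂ H S} (χ : H →* ℂˣ) (ρV : Representation ℂ G S)
  (hc : ∀ (g : G) (h : H), Commute (ρV g) (ρW h))

/-- **The isotypic MODEL of the coinvariants as a `G`-embedding** (`H` compact, `ρW` smooth, `ker χ` open): there is an injective `ℂ`-linear map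
`f : S_{H,χ} → S` intertwining `rep χ ρV hc` with `ρV`, namely the inverse of the dictionary ★ `exists_linearEquiv_weightSpace_coinv` followed by the
inclusion of the `χ`-isotypic subspace (`ρV`-stable by ★ `map_weightSpace_le`; intertwining by ★ `rep_mk`). [cite: BernsteinZelevinsky1976, §2.3] -/
theorem exists_injective_intertwiner_weightSpace (hsm : ρW.IsSmooth) (hχ : IsOpen (χ.ker : Set H)) :
    ∃ f : Coinv ρW χ →ₗ[ℂ] S, Function.Injective f ∧ (∀ (g : G) (x : Coinv ρW χ), f (rep χ ρV hc g x) = ρV g (f x)) ∧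
      ∀ x, f x ∈ weightSpace ρW id (fun h => ((χ h : ℂˣ) : ℂ)) := by
  obtain ⟨e, he⟩ := exists_linearEquiv_weightSpace_coinv ρW χ hsm hχ
  refine ⟨(weightSpace ρW id (fun h => ((χ h : ℂˣ) : ℂ))).subtype ∘ₗ e.symm.toLinearMap,
    (Submodule.injective_subtype _).comp e.symm.injective, fun g x => ?_, fun x => (e.symm x).2⟩
  -- write `x = e w` with `w` an eigenvector; `ρV g w` is again an eigenvector and `rep g (mk w) = mk (ρV g w)`
  obtain ⟨w, rfl⟩ := e.surjective x
  have hgw : ρV g (w : S) ∈ weightSpace ρW id (fun h => ((χ h : ℂˣ) : ℂ)) :=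
    map_weightSpace_le ρW χ (ρV g) (hc g) ⟨w, w.2, rfl⟩
  have hrep : rep χ ρV hc g (e w) = e ⟨ρV g (w : S), hgw⟩ := by
    rw [he, he, rep_mk]
  rw [LinearMap.comp_apply, LinearMap.comp_apply]
  change (weightSpace ρW id (fun h => ((χ h : ℂˣ) : ℂ))).subtype (e.symm (rep χ ρV hc g (e w))) =
    ρV g ((weightSpace ρW id (fun h => ((χ h : ℂˣ) : ℂ))).subtype (e.symm (e w)))
  rw [hrep, LinearEquiv.symm_apply_apply, LinearEquiv.symm_apply_apply, Submodule.subtype_apply, Submodule.subtype_apply]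

/-- **STUB U1b of `Cruxes/H413/Lines/F0_P3b_KeysPnUnitaryPaydown.lean` — twisted coinvariants by a COMPACT group acting SMOOTHLY inherit unitarizability**:
for `ρW : H → GL(S)` smooth with `H` compact, `χ : H →* ℂˣ` any character, and a unitarizable `ρV : G → GL(S)` commuting with `ρW(H)`, the representation
`TwistedCoinv.rep χ ρV hc` of `G` on the `χ`-coinvariants is unitarizable.  By the dichotomy `isOpen_ker_or_subsingleton_coinv`: if `ker χ` is open, restrict the
invariant form of `ρV` along the isotypic model `exists_injective_intertwiner_weightSpace` (`IsUnitarizable.of_injective_intertwiner`); otherwise the coinvariants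
vanish (`IsUnitarizable.of_subsingleton`). [cite: BernsteinZelevinsky1976, §2.3] [cite: MoeglinVignerasWaldspurger1987, Chap. 2 II.2] [cite: BushnellHenniart2006, §2.6] -/
theorem isUnitarizable_rep (hsm : ρW.IsSmooth) (hρV : ρV.IsUnitarizable) : (rep χ ρV hc).IsUnitarizable := by
  rcases isOpen_ker_or_subsingleton_coinv ρW χ hsm with hχ | hsub
  · obtain ⟨f, hinj, hf, -⟩ := exists_injective_intertwiner_weightSpace χ ρV hc hsm hχ
    exact hρV.of_injective_intertwiner f hf hinj
  · exact Representation.IsUnitarizable.of_subsingleton _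

end Compact

end Literature.RepresentationTheory.TwistedCoinv

end
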